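import Summits.HodgeConjecture.HodgeConjecture.Theorems.K2E1BLConstantTermProjectionU2          -- ★ p858855 FILE A (imports ★ leaf p858761): `Z`, `Y`, `qN`, `mN`, `zFun`, `forall_mem_adelicUnipBorelSubgroup_mul_eq`
import Literature.NumberTheory.Automorphic.UnitaryGroupTruncatedKernelMeasurable                 -- ★ Borel descent kit: brings ★ `isClosed_quotientSubgroup_quasiSplit`, `quotientSubgroup_quasiSplit`, the adelic instances, ★ `InvariantQuotientUnfolding`
import Literature.NumberTheory.Automorphic.UnitaryGroupRationalLeviDecomposition                  -- ★ `torusPart_mem_arithmeticSubgroup` (torus parts of rational Borel elements are rational)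
import Literature.NumberTheory.Automorphic.UnitaryGroupUnipotentHaarTorusConj                     -- ★ `torusPart_inv`
import Mathlib.MeasureTheory.Constructions.Polish.Basic                                           -- Mathlib `Continuous.map_eq_borel`
import HarnessLib

/-!
# Borel descent to `Z = B(F)∖G(𝔸)` and to the base `Y = N(𝔸)B(F)∖G(𝔸)`: an invariant BOREL function on `G(𝔸)` has a measurable descent —
# the L²-class upgrade of FILE A's continuity device for the `N(𝔸)`-invariant σ-algebra `mN`

Campaign «EIS-R7-BL-SPH-2∕3», deal `hcnst` half (ii) «P2b-side, general class» (dealer K2E1-plan (g6) (17)∕(21), 2026-09-04T09:53Z): FILE M, the measurability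
infrastructure split off (letter-free, EVERY rank `N`).  THEOREMS ONLY (no `def`, no `instance`, no notation, no named-fact hypothesis, no `sorry`); lane
`--supports stmt-HodgeConjecture-24833 --as helper` (count-neutral).  Closes no socket.

WHY.  ★ FILE A identifies the constant-term projection `cnst_k (toHN φ) = toHN (φ_B)` for functions `φ` whose fibre average `φ_B` is CONTINUOUS: the `mN`-measurability of `zFun φ_B`
is obtained by descending a continuous `N(𝔸)B(F)`-invariant function along the topological quotient `G(𝔸) → Y` (★ `aestronglyMeasurable_invariantSigma_zFun`).  For an L²-CLASS
`f ∈ 𝓗_k(Z_c)` (K1-L²'s `hcnst`, the truncated lift `𝟙_{c<H}·⇑f ∘ π`) the fibre average is only BOREL on `G(𝔸)`; its descent needs «Borel sets of the orbit space = saturated Borel sets»,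
i.e. `MeasurableSpace.map (Y.mk) (borel G(𝔸)) = borel Y` — Mathlib `Continuous.map_eq_borel` for the continuous open surjection from the POLISH group `G(𝔸)` (★
`polishSpace_of_locallyCompactSpace_of_secondCountableTopology`) onto the `T₀` second-countable orbit space `Y`.  The one structural input is that **`N(𝔸)B(F)` is CLOSED**:
`N(𝔸)B(F) = {b ∈ B(𝔸) : torusPart b ∈ G(F)}` (★ `torusPart` is a homomorphism killing `N(𝔸)`, ★ torus parts of rational Borel elements are rational), the preimage of the closed
discrete `G(F)` (★ `isClosed_quotientSubgroup_quasiSplit`) under the continuous `torusPart` inside the closed `B(𝔸)` (★ `isClosed_borelAdelic`).  The same road for the discrete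
`B(F)` gives Borel descent to `Z` itself.

* §1 `isClosed_arithmeticSubgroup_quasiSplit`, `isClosed_setOf_mem_ratBorelSubgroup`, `mem_adelicUnipBorelSubgroup_iff_torusPart_mem` (`N(𝔸)B(F) = {b ∈ B(𝔸) : torusPart b ∈ G(F)}`),
  **`isClosed_setOf_mem_adelicUnipBorelSubgroup`**.
* §2 orbit spaces of closed subgroups (generic): `isClosed_preimage_mk_singleton`, `t1Space_orbitRel_quotient_of_isClosed`; `t1Space_borelQuotient`, `t1Space_adelicBorelQuotient`,
  `secondCountableTopology_borelQuotient`, `secondCountableTopology_adelicBorelQuotient` (theorems, usable by `haveI`).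
* §3 **`map_toBorelQuotient_eq_borel`**, **`map_qN_comp_toBorelQuotient_eq_borel`** (Borel σ-algebras of `Z` and `Y` are the push-forwards from `G(𝔸)`);
  **`measurable_zFun_of_measurable`** (`B(F)`-invariant Borel `Ψ` ⇒ `zFun Ψ` Borel on `Z`), **`measurable_invariantSigma_zFun_of_measurable`** (`N(𝔸)B(F)`-invariant Borel `Ψ` ⇒
  `zFun Ψ` is `mN`-measurable), `aestronglyMeasurable_invariantSigma_zFun_of_measurable`.
HONEST LABEL: HC_CM is proved only modulo the 7 printed citations (2 remaining named inputs: hLiu418 = `stmt-HodgeConjecture-24832`, h413 = `stmt-HodgeConjecture-24833`)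
until rung 0 closes; this file asserts no named fact and closes no socket.
References: [BernsteinLapid2019] §4 Claim 4 (p. 10) · [MoeglinWaldspurger1995] I.2.1, I.2.6 · [Folland1995] §2.6 · [Kechris1995] A. S. Kechris, *Classical Descriptive Set Theory*, Thm. 15.1.
-/

set_option autoImplicit false
set_option linter.dupNamespace false

noncomputable section

open MeasureTheory Measure NumberField IsDedekindDomain Set Filter Topology
open scoped ENNReal NNReal
open Literature.NumberTheory.Automorphic Literature.NumberTheory.Automorphic.UnitaryGroup AdelicGroupData
open Summit.HodgeConjecture.HodgeConjecture.Cruxes.H413.K2E1BLBorelSpacesU2Defs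
open Summit.HodgeConjecture.HodgeConjecture.Cruxes.H413.K2E1BLConstantTermProjectionU2 (forall_mem_adelicUnipBorelSubgroup_mul_eq)

namespace Summit.HodgeConjecture.HodgeConjecture.Cruxes.H413.K2E1BLInvariantSigmaDescentU

variable {F E : Type} [Field F] [NumberField F] [Field E] [NumberField E] [Algebra F E] {c : E ≃ₐ[F] E} {N : ℕ}

/-! ## §1 `N(𝔸)B(F)` and `B(F)` are closed subgroups of `G(𝔸)` -/

/-- `G(F)` is closed in `G(𝔸)` (★ `isClosed_quotientSubgroup_quasiSplit`, ★ `quotientSubgroup_quasiSplit`). [cite: MoeglinWaldspurger1995, I.2.1] -/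
theorem isClosed_arithmeticSubgroup_quasiSplit : IsClosed (((quasiSplit F E c N).arithmeticSubgroup : Set (quasiSplit F E c N).Adelic)) := by
  have h := isClosed_quotientSubgroup_quasiSplit (F := F) (E := E) (c := c) (N := N)
  rwa [quotientSubgroup_quasiSplit] at h

/-- `B(F) = B(𝔸) ∩ G(F)` is closed in `G(𝔸)` (stated on the membership set `{g | g ∈ B(F)}`, which IS the coercion `↑B(F)`). [cite: MoeglinWaldspurger1995, I.2.1] -/
theorem isClosed_setOf_mem_ratBorelSubgroup : IsClosed {g : (quasiSplit F E c N).Adelic | g ∈ ratBorelSubgroup F E c N} :=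
  (isClosed_borelAdelic (F := F) (E := E) (c := c) (N := N)).inter isClosed_arithmeticSubgroup_quasiSplit

/-- **`N(𝔸)B(F) = {b ∈ B(𝔸) : torusPart b ∈ G(F)}`**: membership in the join `N(𝔸) ⊔ B(F)` is «Borel with rational torus part» (★ `torusPart` is a homomorphism with kernel `N(𝔸)`,
★ torus parts of rational Borel elements are rational). [cite: MoeglinWaldspurger1995, I.2.1] -/
theorem mem_adelicUnipBorelSubgroup_iff_torusPart_mem (g : (quasiSplit F E c N).Adelic) :
    g ∈ adelicUnipBorelSubgroup F E c N ↔ ∃ hg : g ∈ borelAdelic F E c N,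
      ((torusPart (⟨g, hg⟩ : borelAdelic F E c N) : borelAdelic F E c N) : (quasiSplit F E c N).Adelic) ∈ (quasiSplit F E c N).arithmeticSubgroup := by
  -- the right-hand side is a subgroup `P` with `N(𝔸), B(F) ≤ P ≤ N(𝔸) ⊔ B(F)`
  let P : Subgroup (quasiSplit F E c N).Adelic :=
    { carrier := {g | ∃ hg : g ∈ borelAdelic F E c N,
        ((torusPart (⟨g, hg⟩ : borelAdelic F E c N) : borelAdelic F E c N) : (quasiSplit F E c N).Adelic) ∈ (quasiSplit F E c N).arithmeticSubgroup}
      mul_mem' := by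
        rintro a b ⟨ha, ha'⟩ ⟨hb, hb'⟩
        refine ⟨Subgroup.mul_mem _ ha hb, ?_⟩
        have h : torusPart (⟨a * b, Subgroup.mul_mem _ ha hb⟩ : borelAdelic F E c N) =
            torusPart (⟨a, ha⟩ : borelAdelic F E c N) * torusPart (⟨b, hb⟩ : borelAdelic F E c N) := torusPart_mul ⟨a, ha⟩ ⟨b, hb⟩
        rw [h, Subgroup.coe_mul]
        exact Subgroup.mul_mem _ ha' hb'
      one_mem' := ⟨Subgroup.one_mem _, by
        rw [torusPart_eq_one_of_mem (Subgroup.one_mem _), Subgroup.coe_one]; exact Subgroup.one_mem _⟩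
      inv_mem' := by
        rintro a ⟨ha, ha'⟩
        refine ⟨Subgroup.inv_mem _ ha, ?_⟩
        have h : torusPart (⟨a⁻¹, Subgroup.inv_mem _ ha⟩ : borelAdelic F E c N) = (torusPart (⟨a, ha⟩ : borelAdelic F E c N))⁻¹ := torusPart_inv ⟨a, ha⟩
        rw [h, Subgroup.coe_inv]
        exact Subgroup.inv_mem _ ha' }
  have hle : adelicUnipBorelSubgroup F E c N ≤ P := by
    refine sup_le (fun u hu => ⟨adelicUnipotent_le_borelAdelic hu, ?_⟩) (fun b hb => ⟨hb.1, torusPart_mem_arithmeticSubgroup hb.2⟩)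
    rw [torusPart_eq_one_of_mem hu, Subgroup.coe_one]
    exact Subgroup.one_mem _
  refine ⟨fun h => hle h, ?_⟩
  rintro ⟨hg, hg'⟩
  -- `g = t · (t⁻¹ g)`, `t = torusPart g ∈ B(F)`, `t⁻¹ g ∈ N(𝔸)`
  have ht : ((torusPart (⟨g, hg⟩ : borelAdelic F E c N) : borelAdelic F E c N) : (quasiSplit F E c N).Adelic) ∈ ratBorelSubgroup F E c N :=
    ⟨(torusPart (⟨g, hg⟩ : borelAdelic F E c N)).2, hg'⟩
  have hn := torusPart_inv_mul_mem_adelicUnipotent (⟨g, hg⟩ : borelAdelic F E c N)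
  have heq : g = ((torusPart (⟨g, hg⟩ : borelAdelic F E c N) : borelAdelic F E c N) : (quasiSplit F E c N).Adelic) *
      ((((torusPart (⟨g, hg⟩ : borelAdelic F E c N))⁻¹ * ⟨g, hg⟩ : borelAdelic F E c N)) : (quasiSplit F E c N).Adelic) := by
    rw [Subgroup.coe_mul, Subgroup.coe_inv, mul_inv_cancel_left]
  rw [heq]
  exact Subgroup.mul_mem _ (Subgroup.mem_sup_right ht) (Subgroup.mem_sup_left hn)

/-- **`N(𝔸)B(F)` is CLOSED in `G(𝔸)`** (stated on the membership set `{g | g ∈ N(𝔸)B(F)}` = `↑(N(𝔸)B(F))`) — the preimage of the closed discrete `G(F)` under the continuous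
`torusPart`, inside the closed `B(𝔸)`. [cite: MoeglinWaldspurger1995, I.2.1] -/
theorem isClosed_setOf_mem_adelicUnipBorelSubgroup : IsClosed {g : (quasiSplit F E c N).Adelic | g ∈ adelicUnipBorelSubgroup F E c N} := by
  have hce : IsClosedEmbedding (fun b : borelAdelic F E c N => (b : (quasiSplit F E c N).Adelic)) :=
    (isClosed_borelAdelic (F := F) (E := E) (c := c) (N := N)).isClosedEmbedding_subtypeVal
  have hS : IsClosed {b : borelAdelic F E c N | ((torusPart b : borelAdelic F E c N) : (quasiSplit F E c N).Adelic) ∈ (quasiSplit F E c N).arithmeticSubgroup} :=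
    isClosed_arithmeticSubgroup_quasiSplit.preimage (continuous_subtype_val.comp continuous_torusPart)
  have heq : {g : (quasiSplit F E c N).Adelic | g ∈ adelicUnipBorelSubgroup F E c N} =
      (fun b : borelAdelic F E c N => (b : (quasiSplit F E c N).Adelic)) ''
        {b : borelAdelic F E c N | ((torusPart b : borelAdelic F E c N) : (quasiSplit F E c N).Adelic) ∈ (quasiSplit F E c N).arithmeticSubgroup} := by
    ext g
    rw [mem_setOf_eq, mem_adelicUnipBorelSubgroup_iff_torusPart_mem]
    constructor
    · rintro ⟨hg, hg'⟩
      exact ⟨⟨g, hg⟩, hg', rfl⟩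
    · rintro ⟨b, hb, rfl⟩
      exact ⟨b.2, hb⟩
  rw [heq]
  exact hce.isClosedMap _ hS

/-! ## §2 Orbit spaces of closed subgroups: `T₁` and second countable -/

section Orbit

variable {G : Type*} [Group G] [TopologicalSpace G] [IsTopologicalGroup G] (S : Subgroup G)

/-- The fibre of the orbit map over a point is the orbit `S·g`, closed when `S` is. [cite: Folland1995, §2.6] -/
theorem isClosed_preimage_mk_singleton (hS : IsClosed (S : Set G)) (g : G) :
    IsClosed ((Quotient.mk (MulAction.orbitRel S G)) ⁻¹' {Quotient.mk (MulAction.orbitRel S G) g}) := by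
  have heq : (Quotient.mk (MulAction.orbitRel S G)) ⁻¹' {Quotient.mk (MulAction.orbitRel S G) g} = (fun s : G => s * g) '' (S : Set G) := by
    ext x
    rw [mem_preimage, mem_singleton_iff, Quotient.eq, MulAction.orbitRel_apply, MulAction.mem_orbit_iff]
    constructor
    · rintro ⟨s, rfl⟩
      exact ⟨s, s.2, rfl⟩
    · rintro ⟨s, hs, rfl⟩
      exact ⟨⟨s, hs⟩, rfl⟩
  rw [heq]
  exact (Homeomorph.mulRight g).isClosedMap _ hS

/-- **The orbit space `S∖G` of a CLOSED subgroup is `T₁`.** [cite: Folland1995, §2.6] -/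
theorem t1Space_orbitRel_quotient_of_isClosed (hS : IsClosed (S : Set G)) : T1Space (Quotient (MulAction.orbitRel S G)) := by
  refine ⟨fun q => ?_⟩
  obtain ⟨g, rfl⟩ := Quotient.exists_rep q
  exact isQuotientMap_quotient_mk'.isClosed_preimage.1 (isClosed_preimage_mk_singleton S hS g)

end Orbit

/-- `Z = B(F)∖G(𝔸)` is `T₁`. [cite: BernsteinLapid2019, §4 p. 9] -/
theorem t1Space_borelQuotient : T1Space (borelQuotient F E c N) :=
  t1Space_orbitRel_quotient_of_isClosed _ isClosed_setOf_mem_ratBorelSubgroup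

/-- `Y = N(𝔸)B(F)∖G(𝔸)` is `T₁`. [cite: BernsteinLapid2019, §4 p. 10] -/
theorem t1Space_adelicBorelQuotient : T1Space (adelicBorelQuotient F E c N) :=
  t1Space_orbitRel_quotient_of_isClosed _ isClosed_setOf_mem_adelicUnipBorelSubgroup

/-- `Z = B(F)∖G(𝔸)` is second countable (open orbit map, Mathlib `ContinuousConstSMul.secondCountableTopology`). [cite: BernsteinLapid2019, §4 p. 9] -/
theorem secondCountableTopology_borelQuotient : SecondCountableTopology (borelQuotient F E c N) := by
  haveI := secondCountableTopology_adeleRing E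
  haveI : SecondCountableTopology (quasiSplit F E c N).Adelic := inferInstanceAs (SecondCountableTopology (adelic F E c N ((StdForm.antidiagonal N).over E)))
  exact ContinuousConstSMul.secondCountableTopology

/-- `Y = N(𝔸)B(F)∖G(𝔸)` is second countable. [cite: BernsteinLapid2019, §4 p. 10] -/
theorem secondCountableTopology_adelicBorelQuotient : SecondCountableTopology (adelicBorelQuotient F E c N) := by
  haveI := secondCountableTopology_adeleRing E
  haveI : SecondCountableTopology (quasiSplit F E c N).Adelic := inferInstanceAs (SecondCountableTopology (adelic F E c N ((StdForm.antidiagonal N).over E)))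
  exact ContinuousConstSMul.secondCountableTopology

/-! ## §3 Borel σ-algebras of `Z` and `Y` as push-forwards; Borel descent of invariant functions -/

section Descent

variable [MeasurableSpace (quasiSplit F E c N).Adelic] [BorelSpace (quasiSplit F E c N).Adelic]

omit [MeasurableSpace (quasiSplit F E c N).Adelic] [BorelSpace (quasiSplit F E c N).Adelic] in
/-- `G(𝔸)` is Polish (locally compact, second countable, Hausdorff ★). [cite: Kechris1995, Thm. 5.3] -/
theorem polishSpace_adelic : PolishSpace (quasiSplit F E c N).Adelic := by
  haveI := locallyCompactSpace_adeleRing' E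
  haveI : T2Space (quasiSplit F E c N).Adelic := inferInstanceAs (T2Space (adelic F E c N ((StdForm.antidiagonal N).over E)))
  haveI : LocallyCompactSpace (quasiSplit F E c N).Adelic := inferInstanceAs (LocallyCompactSpace (adelic F E c N ((StdForm.antidiagonal N).over E)))
  haveI := secondCountableTopology_adeleRing E
  haveI : SecondCountableTopology (quasiSplit F E c N).Adelic := inferInstanceAs (SecondCountableTopology (adelic F E c N ((StdForm.antidiagonal N).over E)))
  exact Literature.Topology.Metrizable.polishSpace_of_locallyCompactSpace_of_secondCountableTopology _

omit [MeasurableSpace (quasiSplit F E c N).Adelic] [BorelSpace (quasiSplit F E c N).Adelic] in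
/-- `qN ∘ π` is the orbit map of `N(𝔸)B(F)` (definitional). [cite: BernsteinLapid2019, §4 p. 10] -/
theorem qN_comp_toBorelQuotient : qN F E c N ∘ toBorelQuotient F E c N =
    fun g => (Quotient.mk (MulAction.orbitRel (adelicUnipBorelSubgroup F E c N) (quasiSplit F E c N).Adelic) g : adelicBorelQuotient F E c N) := rfl

/-- **The Borel σ-algebra of `Z` is the push-forward of that of `G(𝔸)` along `π`** (Mathlib `Continuous.map_eq_borel`: `G(𝔸)` Polish, `π` continuous surjective, `Z` `T₁` second countable).
[cite: Kechris1995, Thm. 15.1] -/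
theorem map_toBorelQuotient_eq_borel :
    MeasurableSpace.map (toBorelQuotient F E c N) ‹MeasurableSpace (quasiSplit F E c N).Adelic› = borel (borelQuotient F E c N) := by
  haveI := polishSpace_adelic (F := F) (E := E) (c := c) (N := N)
  haveI := t1Space_borelQuotient (F := F) (E := E) (c := c) (N := N)
  haveI := secondCountableTopology_borelQuotient (F := F) (E := E) (c := c) (N := N)
  exact (continuous_toBorelQuotient F E c N).map_eq_borel (Quotient.mk_surjective)

/-- **The Borel σ-algebra of `Y` is the push-forward of that of `G(𝔸)` along `qN ∘ π`**. [cite: Kechris1995, Thm. 15.1] -/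
theorem map_qN_comp_toBorelQuotient_eq_borel :
    MeasurableSpace.map (qN F E c N ∘ toBorelQuotient F E c N) ‹MeasurableSpace (quasiSplit F E c N).Adelic› = borel (adelicBorelQuotient F E c N) := by
  haveI := polishSpace_adelic (F := F) (E := E) (c := c) (N := N)
  haveI := t1Space_adelicBorelQuotient (F := F) (E := E) (c := c) (N := N)
  haveI := secondCountableTopology_adelicBorelQuotient (F := F) (E := E) (c := c) (N := N)
  exact ((continuous_qN F E c N).comp (continuous_toBorelQuotient F E c N)).map_eq_borel
    (fun y => by
      obtain ⟨g, rfl⟩ := Quotient.exists_rep y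
      exact ⟨g, rfl⟩)

/-- **BOREL DESCENT TO `Z`**: a Borel, left-`B(F)`-invariant `Ψ : G(𝔸) → ℂ` has Borel descent `zFun Ψ` on `Z` (`zFun Ψ ∘ π = Ψ` ★ and §3's push-forward identity).
[cite: MoeglinWaldspurger1995, I.2.6] [cite: Kechris1995, Thm. 15.1] -/
theorem measurable_zFun_of_measurable {Ψ : (quasiSplit F E c N).Adelic → ℂ} (hΨm : Measurable Ψ) (hΨ : ∀ γ ∈ ratBorelSubgroup F E c N, ∀ g, Ψ (γ * g) = Ψ g) :
    Measurable (zFun F E c N Ψ) := by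
  have heq : zFun F E c N Ψ ∘ toBorelQuotient F E c N = Ψ := funext fun g => zFun_toBorelQuotient F E c N hΨ g
  intro s hs
  have hs' : MeasurableSet[borel (borelQuotient F E c N)] (zFun F E c N Ψ ⁻¹' s) := by
    rw [← map_toBorelQuotient_eq_borel (F := F) (E := E) (c := c) (N := N), MeasurableSpace.map_def, ← preimage_comp, heq]
    exact hΨm hs
  exact hs'

/-- **BOREL DESCENT TO THE BASE ∕ `mN`-MEASURABILITY**: a Borel, left-`N(𝔸)B(F)`-invariant `Ψ : G(𝔸) → ℂ` has `mN`-measurable descent `zFun Ψ` (`mN = comap qN (borel Y)`,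
`zFun Ψ = Ψ̃ ∘ qN` with `Ψ̃ ∘ (qN ∘ π) = Ψ` Borel by the push-forward identity) — the L²-class upgrade of ★ FILE A's `aestronglyMeasurable_invariantSigma_zFun` (no continuity).
[cite: BernsteinLapid2019, §4 Claim 4 (p. 10)] [cite: MoeglinWaldspurger1995, I.2.6] -/
theorem measurable_invariantSigma_zFun_of_measurable {Ψ : (quasiSplit F E c N).Adelic → ℂ} (hΨm : Measurable Ψ)
    (hΨ : ∀ x ∈ adelicUnipBorelSubgroup F E c N, ∀ g, Ψ (x * g) = Ψ g) :
    Measurable[invariantSigma F E c N] (zFun F E c N Ψ) := by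
  -- descend to the base
  let Ψb : adelicBorelQuotient F E c N → ℂ :=
    Quotient.lift Ψ fun a b (hab : MulAction.orbitRel (adelicUnipBorelSubgroup F E c N) _ a b) => by
      obtain ⟨x, rfl⟩ := hab
      exact hΨ x x.2 b
  have hB : ∀ γ ∈ ratBorelSubgroup F E c N, ∀ g, Ψ (γ * g) = Ψ g :=
    fun γ hγ g => hΨ γ (ratBorelSubgroup_le_adelicUnipBorelSubgroup F E c N hγ) g
  have heq : zFun F E c N Ψ = Ψb ∘ qN F E c N := by
    funext z
    obtain ⟨g, rfl⟩ := Quotient.exists_rep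
      (z : Quotient (MulAction.orbitRel (ratBorelSubgroup F E c N) (quasiSplit F E c N).Adelic))
    exact zFun_toBorelQuotient F E c N hB g
  have hlift : Ψb ∘ (qN F E c N ∘ toBorelQuotient F E c N) = Ψ := rfl
  -- `Ψb` is Borel on the base by the push-forward identity
  have hΨb : Measurable[borel (adelicBorelQuotient F E c N)] Ψb := by
    intro s hs
    rw [← map_qN_comp_toBorelQuotient_eq_borel (F := F) (E := E) (c := c) (N := N), MeasurableSpace.map_def, ← preimage_comp, hlift]
    exact hΨm hs
  rw [heq]
  exact hΨb.comp (measurable_iff_comap_le.2 le_rfl)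

/-- The `AEStronglyMeasurable[mN]` form, for any measure on `Z`. [cite: BernsteinLapid2019, §4 Claim 4 (p. 10)] -/
theorem aestronglyMeasurable_invariantSigma_zFun_of_measurable {Ψ : (quasiSplit F E c N).Adelic → ℂ} (hΨm : Measurable Ψ)
    (hΨ : ∀ x ∈ adelicUnipBorelSubgroup F E c N, ∀ g, Ψ (x * g) = Ψ g) (μ : Measure (borelQuotient F E c N)) :
    AEStronglyMeasurable[invariantSigma F E c N] (zFun F E c N Ψ) μ :=
  ⟨zFun F E c N Ψ, (measurable_invariantSigma_zFun_of_measurable hΨm hΨ).stronglyMeasurable, Filter.EventuallyEq.rfl⟩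

/-- Invariance under `N(𝔸)` and `B(F)` separately suffices (★ FILE A's subgroup device). [cite: BernsteinLapid2019, §4 Claim 4 (p. 10)] -/
theorem measurable_invariantSigma_zFun_of_measurable' {Ψ : (quasiSplit F E c N).Adelic → ℂ} (hΨm : Measurable Ψ)
    (hN : ∀ u : adelicUnipotent F E c N, ∀ g, Ψ ((u : (quasiSplit F E c N).Adelic) * g) = Ψ g)
    (hB : ∀ b ∈ ratBorelSubgroup F E c N, ∀ g, Ψ (b * g) = Ψ g) :
    Measurable[invariantSigma F E c N] (zFun F E c N Ψ) :=
  measurable_invariantSigma_zFun_of_measurable hΨm (forall_mem_adelicUnipBorelSubgroup_mul_eq hN hB)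

end Descent

end Summit.HodgeConjecture.HodgeConjecture.Cruxes.H413.K2E1BLInvariantSigmaDescentU

end
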